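import Summits.HodgeConjecture.CorCM.OcticCurveFourfoldWeilParts
import Summits.HodgeConjecture.CorCM.OcticCurveFourfoldWeilSixfold
import Summits.HodgeConjecture.CorCM.CMWeightLinesDisjointUnion
import Summits.HodgeConjecture.CorCM.Model.CMSliceOfWeilFaces
import HarnessLib

/-!
# COR-CM — the Hodge conjecture for ALL PRODUCTS OF COPIES `B^n × E^a` of a CM abelian fourfold `B` whose OCTIC CM field
# contains the CM field `k` of the elliptic curve `E` (`k`-signature `(1,3)`), GIVEN ONLY Markman's hyperbolic-sixfold
# theorem: assembly (frame form)

Cell `pub-hodgecm2` (COR-CM), seat b30 gen 18 (2026-08-21); count-neutral own lane OCTIC-EB (lit-andre-3's prover-lane ask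
A6-R26 «HC(E^a × B^n) ⇐ `Markman2025_weilClasses_algebraic_hyperbolicSixfold` for the simple CM fourfold of a (ℤ/2)³ /
ℤ/4×ℤ/2-non□ field», GENERALISED: no Galois hypothesis on the octic field, no group).  Theorems only, no definition, no named
fact introduced, no `sorry`.  Assembles `Census/OcticCurveFourfold(Parts)` (combinatorics), `CorCM/OcticCurveFourfoldFrameTransfer`
(frame transfer, pair parts), `CorCM/OcticCurveFourfoldWeilParts` (Weil parts) and `CorCM/OcticCurveFourfoldWeilSixfold`
(the Weil plane of `(B × E) × E` from Markman's theorem), in the pattern of seat b09's `CorCM/DecicCurveFivefoldPowersTransfer`.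

SETTING (frame form; the intrinsic form is `CorCM/OcticCurveFourfoldHodgeOfMarkman.lean`).  `k = Kf i₀` imaginary quadratic
(`[k:ℚ] = 2`, `δ ∈ 𝓞_k`, `δ² = -d`, `τ(δ) = i√d`), `F = Kf i₁ ⊇ i(k)` of degree `8`, read in ANY enumeration
`e : Hom(F, ℂ) ≃ Fin 4 × Bool` with `(e s).2 = [s ∘ i = τ]` (`he_sign`), `e s̄ = ((e s).1, ¬(e s).2)` (`he_conj`);
`A₂ 0 = B ⊨ (F; Φ)` with `Φ = e⁻¹ phi` (`hΦ`; `phi = {(0,true), (1,false), (2,false), (3,false)}` — `k`-signature `(1,3)`),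
`A₂ 1 = E ⊨ (k; {τ})` (`hΨ`).  A power is `X = ⨁_j A₂(κ j)`, `κ : Fin N → Fin 2` ARBITRARY (all `B^n × E^a`, any order).

* `weightClassesAlg_le_algebraicClasses_of_isPairPart` — a pair part of a weight of `X` has an algebraic line (projects to a
  conjugate pair of `Y = B × E`: divisor; distribution lemma);
* `hodgeConjectureFor_biproduct_comp_of_weilPlane₃` — `HodgeConjectureFor (⨁_j A₂ (κ j))` for EVERY `κ`, GIVEN the Weil
  plane of the sixfold `((B × E) × E, (iδ × δ) × δ)` (`hW₃`): Pohlmann's theorem for the CM algebra `∏_j K_{κ j}`, frame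
  transfer, the induction principle over pair parts and WEIL PARTS (`Census/OcticCurveFourfoldParts.modelBalanced_induction`),
  and the multiplicativity of algebraic weight lines (`PairWeights.weightClassesAlg_union_le_algebraicClasses`);
* `typeCount_eq_three_of_frame` — the frame gives the count `#{s ∈ Φ | s ∘ i = τ'} + 2[τ' = τ] = 3` for both `τ'`;
* **`hodgeConjectureFor_biproduct_comp_of_frame_of_markmanSixfold`** — the same GIVEN ONLY the named fact
  `Markman2025_weilClasses_algebraic_hyperbolicSixfold` (`hW₃` by `weilClassesOf_le_algebraicClasses_…_of_markmanSixfold`);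
  `…_of_avDominatedBy_…` — and for every abelian variety dominated by such a power (isogeny factors, quotients, subvarieties).
HONEST FRAMING: CONDITIONAL on Markman's UNREFEREED theorem (arXiv:2502.03415 Thm 1.5.1); `HC_CM` is not asserted; no case of
the Hodge conjecture is claimed unconditionally here.
[cite: Pohlmann1968, Thm 1] [cite: GaoUllmo2025, Thm 3.1] [cite: Milne2020HodgeClassesAV, 1.2 (a) and Thm. 1]
[cite: Deligne1982HodgeCycles, §4–§5] [cite: Markman2025SecantWeil, Thm 1.5.1] [cite: MumfordAV1970, §19]

## References
* [Pohlmann1968] H. Pohlmann, Ann. of Math. 88 (1968), Thm 1.  [GaoUllmo2025] Z. Gao, E. Ullmo, J. Inst. Math. Jussieu 25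
  (2025), Thm 3.1.  [Milne2020HodgeClassesAV] J. S. Milne, arXiv:2010.08857, 1.2 (a), Thm. 1.  [Deligne1982HodgeCycles]
  P. Deligne, LNM 900 (1982), §4 Prop. 4.4, §5 (c).  [Markman2025SecantWeil] E. Markman, arXiv:2502.03415, Thm 1.5.1.
  [MumfordAV1970] D. Mumford, *Abelian Varieties*, §19.  [MoonenZarhin1999LowDim] B. Moonen, Yu. Zarhin, Math. Ann. 315
  (1999), Thm. 0.1 (a).
-/

noncomputable section

open CategoryTheory CategoryTheory.Limits NumberField

namespace Summit.HodgeConjecture.CorCM.OcticCurveFourfold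

open Literature.AlgebraicGeometry Literature.AlgebraicGeometry.Motives Literature.AlgebraicGeometry.HodgeTheory
open Literature.AlgebraicGeometry.ComplexMultiplication (IsCMTypeRealisation)
open Literature.AlgebraicGeometry.Pohlmann1968
open Literature.AlgebraicTopology.SingularHomology
open Literature.NumberTheory.ComplexMultiplication
open Summit.HodgeConjecture.CorCM.Census.OcticCurveFourfold (Pt sgn cj phi phiPre inr_mem_phiPre ModelBalanced IsPairPart
  IsWeilPart modelBalanced_induction cj_facts)
open Summit.HodgeConjecture.CorCM.DecicCurveFivefold (curveSlots₂ sigma_cases)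
open Summit.HodgeConjecture.CorCM.PairWeights
open Summit.HodgeConjecture.CorCM.CMWeights (weightClassesAlg_comp_le_algebraicClasses_of_injOn)
open Summit.HodgeConjecture.CorCM.DihedralSexticPair (card_filter_equiv_mem eq_or_eq_conjugate)

open scoped Classical Pointwise

/-! ## §1 Pair parts of a power have algebraic lines -/

section Parts

variable {I : Type} {Kf : I → Type} [∀ i, Field (Kf i)] [∀ i, NumberField (Kf i)] [∀ i, IsCMField (Kf i)]
  {i₀ i₁ : I} {N : ℕ} (κ : Fin N → Fin 2) {e : (Kf i₁ →+* ℂ) ≃ Fin 4 × Bool} {τ : Kf i₀ →+* ℂ} {i : Kf i₀ →+* Kf i₁}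
  {A₂ : Fin 2 → AbelianVariety ℂ} {Φ₂ : ∀ j : Fin 2, CMType (Kf (curveSlots₂ i₀ i₁ j))}
  {ι₂ : ∀ j, 𝓞 (Kf (curveSlots₂ i₀ i₁ j)) →+* End (A₂ j)}
  {θ₂ : ∀ j, Kf (curveSlots₂ i₀ i₁ j) →+* Module.End ℂ (complexBetti (A₂ j).X 1)}

/-- **A pair part of a weight of `X = ⨁_j A₂(κ j)` has an algebraic (divisor) line**: the model map is injective on it
with image a conjugate pair `{y, cj y}`, so its projection to `Y = ⨁ A₂` is a weight with the same image — a divisor line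
(`weightClassesAlg_le_algebraicClasses_of_image_eq_pair`) — and seat b30's distribution lemma lifts it along `κ`.
[cite: Gordon1999HodgeAVSurvey, 9.2.2] [cite: Milne2020HodgeClassesAV, 1.2 (a) and Thm. 1] -/
theorem weightClassesAlg_le_algebraicClasses_of_isPairPart
    (hττ : ComplexEmbedding.conjugate τ ≠ τ) (hk : ∀ σ : Kf i₀ →+* ℂ, σ = τ ∨ σ = ComplexEmbedding.conjugate τ)
    (he_conj : ∀ s : Kf i₁ →+* ℂ, e (ComplexEmbedding.conjugate s) = ((e s).1, !(e s).2))
    (hA : ∀ j, IsCMTypeRealisation (Φ₂ j) (A₂ j) (ι₂ j) (θ₂ j))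
    {G : Finset ((j : Fin N) × (Kf (curveSlots₂ i₀ i₁ (κ j)) →+* ℂ))}
    (hG : IsPairPart (fun x => toPt e τ ((Sigma.map κ (fun _ => id) :
      ((j : Fin N) × (Kf (curveSlots₂ i₀ i₁ (κ j)) →+* ℂ)) → ((m : Fin 2) × (Kf (curveSlots₂ i₀ i₁ m) →+* ℂ))) x)) G) :
    G.card = 2 * 1 ∧ weightClassesAlg (fun j => A₂ (κ j)) (fun j => ι₂ (κ j)) (2 * 1) G ≤
      algebraicClasses (⨁ fun j => A₂ (κ j)).X 1 := by
  obtain ⟨y, hcard, hinj, himg⟩ := hG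
  set P : ((j : Fin N) × (Kf (curveSlots₂ i₀ i₁ (κ j)) →+* ℂ)) → ((m : Fin 2) × (Kf (curveSlots₂ i₀ i₁ m) →+* ℂ)) :=
    Sigma.map κ (fun _ => id) with hP
  have hPinj : Set.InjOn P ↑G := fun x hx x' hx' h => hinj hx hx' (by change toPt e τ (P x) = toPt e τ (P x'); rw [h])
  set TY : Finset ((m : Fin 2) × (Kf (curveSlots₂ i₀ i₁ m) →+* ℂ)) := G.image P with hTY
  have hTYimg : TY.image (toPt e τ) = {y, cj y} := by rw [hTY, Finset.image_image]; exact himg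
  obtain ⟨-, hYalg⟩ := weightClassesAlg_le_algebraicClasses_of_image_eq_pair hττ hk he_conj hA hTYimg
  have hq : G.card = 2 * 1 := by rw [hcard]
  exact ⟨hq, weightClassesAlg_comp_le_algebraicClasses_of_injOn (K := fun m => Kf (curveSlots₂ i₀ i₁ m)) hA κ hq
    hPinj hYalg⟩

end Parts

/-! ## §2 Assembly for the powers, given the Weil plane of the sixfold -/

section Assembly

variable {I : Type} {Kf : I → Type} [∀ i, Field (Kf i)] [∀ i, NumberField (Kf i)] [∀ i, IsCMField (Kf i)]
  {i₀ i₁ : I} {N : ℕ} (κ : Fin N → Fin 2) {e : (Kf i₁ →+* ℂ) ≃ Fin 4 × Bool} {τ : Kf i₀ →+* ℂ} {i : Kf i₀ →+* Kf i₁}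
  {A₂ : Fin 2 → AbelianVariety ℂ} {Φ₂ : ∀ j : Fin 2, CMType (Kf (curveSlots₂ i₀ i₁ j))}
  {ι₂ : ∀ j, 𝓞 (Kf (curveSlots₂ i₀ i₁ j)) →+* End (A₂ j)}
  {θ₂ : ∀ j, Kf (curveSlots₂ i₀ i₁ j) →+* Module.End ℂ (complexBetti (A₂ j).X 1)}
  {δ : 𝓞 (Kf i₀)} {d : ℕ}

/-- **`HodgeConjectureFor (⨁_j A₂ (κ j))` from the frame and the Weil plane of the sixfold `(B × E) × E`** (any slot map
`κ`): every rational `(p,p)`-class of the product of copies is algebraic.  Pohlmann's theorem for the CM algebra `∏_j K_{κ j}`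
(`Pohlmann1968_thm1_cmAlgebra`), frame transfer (`modelBalanced_of_isGaloisBalancedAlg`), the induction principle for
balanced configurations over pair parts and Weil parts (`Census/OcticCurveFourfoldParts`), the two part lemmas, and the
multiplicativity of algebraic weight lines (`PairWeights.weightClassesAlg_union_le_algebraicClasses`).
[cite: Pohlmann1968, Thm 1] [cite: GaoUllmo2025, Thm 3.1] [cite: Milne2020HodgeClassesAV, 1.2 (a) and Thm. 1] -/
theorem hodgeConjectureFor_biproduct_comp_of_weilPlane₃
    (hττ : ComplexEmbedding.conjugate τ ≠ τ) (hk : ∀ σ : Kf i₀ →+* ℂ, σ = τ ∨ σ = ComplexEmbedding.conjugate τ)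
    (hτ : τ (δ : Kf i₀) = Complex.I * (Real.sqrt d : ℂ))
    (hA : ∀ j, IsCMTypeRealisation (Φ₂ j) (A₂ j) (ι₂ j) (θ₂ j))
    (he_sign : ∀ s : Kf i₁ →+* ℂ, (e s).2 = true ↔ s.comp i = τ)
    (he_conj : ∀ s : Kf i₁ →+* ℂ, e (ComplexEmbedding.conjugate s) = ((e s).1, !(e s).2))
    (hΦ : ∀ s : Kf i₁ →+* ℂ, s ∈ (Φ₂ 0).1 ↔ Sum.inr (e s) ∈ phi)
    (hΨ : ∀ σ : Kf i₀ →+* ℂ, σ ∈ (Φ₂ (0 : Fin 1).succ).1 ↔ σ = τ)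
    (hW₃ : weilClassesOf (((A₂ 0).prod (A₂ 1)).prod (A₂ 1))
      (AbelianVariety.prodLift
        (AbelianVariety.fst ((A₂ 0).prod (A₂ 1)) (A₂ 1) ≫
          AbelianVariety.prodLift (AbelianVariety.fst (A₂ 0) (A₂ 1) ≫ ι₂ 0 (RingOfIntegers.mapRingHom i δ))
            (AbelianVariety.snd (A₂ 0) (A₂ 1) ≫ ι₂ 1 δ))
        (AbelianVariety.snd ((A₂ 0).prod (A₂ 1)) (A₂ 1) ≫ ι₂ 1 δ)) 3 d ≤
      algebraicClasses (((A₂ 0).prod (A₂ 1)).prod (A₂ 1)).X 3) :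
    HodgeConjectureFor (⨁ fun j => A₂ (κ j)).dim (⨁ fun j => A₂ (κ j)).X := by
  refine ⟨nonempty_hodgeModel_holds (Motives.AbelianVariety.isSmoothProjective_holds (A := ⨁ fun j => A₂ (κ j))),
    fun p c hc hH => ?_⟩
  have hAκ : ∀ j, IsCMTypeRealisation (Φ₂ (κ j)) (A₂ (κ j)) (ι₂ (κ j)) (θ₂ (κ j)) := fun j => hA (κ j)
  -- every balanced configuration has algebraic weight lines: induct over its generating parts
  have key : ∀ (R : Finset ((j : Fin N) × (Kf (curveSlots₂ i₀ i₁ (κ j)) →+* ℂ))),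
      ModelBalanced (fun x => toPt e τ ((Sigma.map κ (fun _ => id) :
        ((j : Fin N) × (Kf (curveSlots₂ i₀ i₁ (κ j)) →+* ℂ)) → ((m : Fin 2) × (Kf (curveSlots₂ i₀ i₁ m) →+* ℂ))) x)) R →
      ∀ q, R.card = 2 * q → weightClassesAlg (fun j => A₂ (κ j)) (fun j => ι₂ (κ j)) (2 * q) R ≤
        algebraicClasses (⨁ fun j => A₂ (κ j)).X q := by
    intro R hR
    refine modelBalanced_induction (motive := fun R => ∀ q, R.card = 2 * q →
      weightClassesAlg (fun j => A₂ (κ j)) (fun j => ι₂ (κ j)) (2 * q) R ≤ algebraicClasses (⨁ fun j => A₂ (κ j)).X q)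
      (fun q hq => ?_) (fun G R hGR hG ih q hq => ?_) (fun G R b hGR hG ih q hq => ?_) hR
    · obtain rfl : q = 0 := by simpa using hq.symm
      exact fun c _ => hodgeConjectureFor_codim_zero c
    · -- a pair part
      obtain ⟨ha, hGalg⟩ := weightClassesAlg_le_algebraicClasses_of_isPairPart κ hττ hk he_conj hA hG
      have hRcard : R.card = 2 * (q - 1) := by
        have h := Finset.card_union_of_disjoint hGR
        rw [hq, ha] at h
        omega
      have haq : 1 + (q - 1) = q := by
        have h := Finset.card_union_of_disjoint hGR
        rw [hq, ha] at h
        omega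
      rw [← Finset.disjUnion_eq_union G R hGR]
      exact weightClassesAlg_union_le_algebraicClasses hAκ haq ha hRcard hGR hGalg (ih (q - 1) hRcard)
    · -- a Weil part
      have ha : G.card = 2 * 3 := hG.1
      have hGalg := weightClassesAlg_le_algebraicClasses_of_isWeilPart hk he_sign hA hτ hW₃ κ hG
      have hRcard : R.card = 2 * (q - 3) := by
        have h := Finset.card_union_of_disjoint hGR
        rw [hq, ha] at h
        omega
      have haq : 3 + (q - 3) = q := by
        have h := Finset.card_union_of_disjoint hGR
        rw [hq, ha] at h
        omega
      rw [← Finset.disjUnion_eq_union G R hGR]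
      exact weightClassesAlg_union_le_algebraicClasses hAκ haq ha hRcard hGR hGalg (ih (q - 3) hRcard)
  have hmem : c ∈ ⨆ S ∈ pohlmannSetsAlg (K := fun j => Kf (curveSlots₂ i₀ i₁ (κ j))) (fun j => Φ₂ (κ j)) p,
      weightClassesAlg (fun j => A₂ (κ j)) (fun j => ι₂ (κ j)) (2 * p) S := by
    rw [← (Pohlmann1968_thm1_cmAlgebra (fun j => Kf (curveSlots₂ i₀ i₁ (κ j))) (fun j => A₂ (κ j))
      (fun j => Φ₂ (κ j)) (fun j => ι₂ (κ j)) (fun j => θ₂ (κ j)) hAκ p).1]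
    exact Submodule.subset_span ⟨hc, hH⟩
  have hle : (⨆ S ∈ pohlmannSetsAlg (K := fun j => Kf (curveSlots₂ i₀ i₁ (κ j))) (fun j => Φ₂ (κ j)) p,
      weightClassesAlg (fun j => A₂ (κ j)) (fun j => ι₂ (κ j)) (2 * p) S) ≤
      algebraicClasses (⨁ fun j => A₂ (κ j)).X p := by
    refine iSup₂_le fun S hS => ?_
    exact key S (modelBalanced_of_isGaloisBalancedAlg hττ hk he_sign he_conj hΦ hΨ κ hS.2) p hS.1
  exact hle hmem

/-! ### The count `(1 + 2·1, 3 + 2·0) = (3, 3)` read off the frame -/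

omit [∀ i, NumberField (Kf i)] [∀ i, IsCMField (Kf i)] in
/-- The finite facts: in the model, exactly one point of `phi` has sign `true` on the fourfold, and three have sign
`false`. [folklore] -/
theorem card_phi_sign :
    ((Finset.univ : Finset (Fin 4 × Bool)).filter fun p => p.2 = true ∧ Sum.inr p ∈ phi).card = 1 ∧
    ((Finset.univ : Finset (Fin 4 × Bool)).filter fun p => p.2 = false ∧ Sum.inr p ∈ phi).card = 3 := by
  have h1 : ((Finset.univ : Finset (Fin 4 × Bool)).filter fun p => p.2 = true ∧ Sum.inr p ∈ phi) =
      (Finset.univ : Finset (Fin 4 × Bool)).filter fun p => p = (0, true) := by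
    refine Finset.filter_congr fun p _ => ?_
    rw [phi, inr_mem_phiPre]
    constructor
    · rintro ⟨h2, h | ⟨hb, -⟩⟩
      · exact h
      · exact absurd h2 hb
    · rintro rfl; exact ⟨rfl, Or.inl rfl⟩
  have h2 : ((Finset.univ : Finset (Fin 4 × Bool)).filter fun p => p.2 = false ∧ Sum.inr p ∈ phi) =
      (Finset.univ : Finset (Fin 4 × Bool)).filter fun p => p.2 = false ∧ p.1 ≠ 0 := by
    refine Finset.filter_congr fun p _ => ?_
    rw [phi, inr_mem_phiPre]
    constructor
    · rintro ⟨h2, h | ⟨-, ha⟩⟩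
      · rw [h] at h2; exact absurd h2 (by decide)
      · exact ⟨h2, ha⟩
    · rintro ⟨h2, ha⟩
      exact ⟨h2, Or.inr ⟨by rw [h2]; decide, ha⟩⟩
  rw [h1, h2]
  exact ⟨by decide, by decide⟩

omit [∀ i, IsCMField (Kf i)] in
/-- **The type count read off the frame**: for `Φ = e⁻¹ phi`, `Ψ = {τ}` and `(e s).2 = [s ∘ i = τ]`, every complex
embedding `τ'` of `k` has `#{s ∈ Φ : s ∘ i = τ'} + 2·[τ' ∈ Ψ] = 3` (`1 + 2` over `τ`, `3 + 0` over `τ̄`) — the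
Weil-type condition of `isWeilType_cmFourfold_prod_cmCurve_prod_cmCurve` (multiplicities `(3,3)` of `k` on
`H^{1,0}((B × E) × E)`). [cite: Deligne1982HodgeCycles, §5 (c)] [cite: MoonenZarhin1998WeilClasses, §1] -/
theorem typeCount_eq_three_of_frame (h2 : Module.finrank ℚ (Kf i₀) = 2) (hd : 0 < d)
    (hτ : τ (δ : Kf i₀) = Complex.I * (Real.sqrt d : ℂ))
    (he_sign : ∀ s : Kf i₁ →+* ℂ, (e s).2 = true ↔ s.comp i = τ)
    {Φ : CMType (Kf i₁)} (hΦ : ∀ s : Kf i₁ →+* ℂ, s ∈ Φ.1 ↔ Sum.inr (e s) ∈ phi)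
    {Ψ : CMType (Kf i₀)} (hΨ : ∀ σ : Kf i₀ →+* ℂ, σ ∈ Ψ.1 ↔ σ = τ) (τ' : Kf i₀ →+* ℂ) :
    (Finset.univ.filter fun s : Kf i₁ →+* ℂ => s.comp i = τ' ∧ s ∈ Φ.1).card + 2 * (if τ' ∈ Ψ.1 then 1 else 0) = 3 := by
  have hττ : ComplexEmbedding.conjugate τ ≠ τ := CMThreefoldPair.conjugate_ne_of_apply_eq hd hτ
  have hk : ∀ σ : Kf i₀ →+* ℂ, σ = τ ∨ σ = ComplexEmbedding.conjugate τ := fun σ => eq_or_eq_conjugate h2 hd hτ σ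
  rcases hk τ' with rfl | rfl
  · rw [if_pos ((hΨ τ').2 rfl)]
    have hfilter : (Finset.univ.filter fun s : Kf i₁ →+* ℂ => s.comp i = τ' ∧ s ∈ Φ.1) =
        Finset.univ.filter fun s => e s ∈
          ((Finset.univ : Finset (Fin 4 × Bool)).filter fun p => p.2 = true ∧ Sum.inr p ∈ phi) := by
      refine Finset.filter_congr fun s _ => ?_
      rw [← he_sign, hΦ s, Finset.mem_filter]
      exact ⟨fun h => ⟨Finset.mem_univ _, h⟩, fun h => h.2⟩
    rw [hfilter, card_filter_equiv_mem, card_phi_sign.1]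
  · have hnot : ComplexEmbedding.conjugate τ ∉ Ψ.1 := fun h => hττ ((hΨ _).1 h)
    rw [if_neg hnot, mul_zero, add_zero]
    have hfilter : (Finset.univ.filter fun s : Kf i₁ →+* ℂ => s.comp i = ComplexEmbedding.conjugate τ ∧ s ∈ Φ.1) =
        Finset.univ.filter fun s => e s ∈
          ((Finset.univ : Finset (Fin 4 × Bool)).filter fun p => p.2 = false ∧ Sum.inr p ∈ phi) := by
      refine Finset.filter_congr fun s _ => ?_
      rw [hΦ s, Finset.mem_filter]
      constructor
      · rintro ⟨h1, h3⟩
        refine ⟨Finset.mem_univ _, ?_, h3⟩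
        cases hs : (e s).2
        · rfl
        · exact absurd (((he_sign s).1 hs).symm.trans h1) hττ.symm
      · rintro ⟨-, h1, h3⟩
        exact ⟨comp_eq_conjugate_of_snd_eq_false hk he_sign h1, h3⟩
    rw [hfilter, card_filter_equiv_mem, card_phi_sign.2]

/-- **MAIN THEOREM (frame form).  The Hodge conjecture for every product of copies `⨁_j A₂(κ j)` of `B` and `E` — i.e. for
`B^n × E^a`, all `n, a`, any order — GIVEN ONLY Markman's hyperbolic-sixfold theorem.**  `k = Kf i₀` imaginary quadratic
(`[k:ℚ] = 2`, `δ² = -d`, `τ(δ) = i√d`), `F = Kf i₁ ⊇ i(k)` of degree `8` (NO Galois hypothesis) read in any enumeration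
`e : Hom(F, ℂ) ≃ Fin 4 × Bool` compatible with signs and conjugation (`he_sign`, `he_conj`), `A₂ 0 = B ⊨ (F; e⁻¹ phi)` (a CM
abelian fourfold of `k`-signature `(1,3)`), `A₂ 1 = E ⊨ (k; {τ})` (the CM curve): every rational `(p,p)`-class on
`⨁_j A₂ (κ j)` is algebraic, for every slot map `κ : Fin N → Fin 2` and every `p`.  Leaves:
`Markman2025_weilClasses_algebraic_hyperbolicSixfold` ONLY (the Weil plane of `(B × E) × E` by
`weilClassesOf_le_algebraicClasses_cmFourfold_prod_cmCurve_prod_cmCurve_of_markmanSixfold`; everything else by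
`hodgeConjectureFor_biproduct_comp_of_weilPlane₃`). [cite: Markman2025SecantWeil, Thm 1.5.1] [cite: Pohlmann1968, Thm 1]
[cite: Deligne1982HodgeCycles, §4 Prop. 4.4 and §5 (c)] [cite: vanGeemen1994HodgeAV, 4.9 and (5.4.1)] -/
theorem hodgeConjectureFor_biproduct_comp_of_frame_of_markmanSixfold
    (hM : Markman2025_weilClasses_algebraic_hyperbolicSixfold) (κ : Fin N → Fin 2)
    (h8 : Module.finrank ℚ (Kf i₁) = 8) (h2 : Module.finrank ℚ (Kf i₀) = 2) (i : Kf i₀ →+* Kf i₁)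
    {δ : 𝓞 (Kf i₀)} {d : ℕ} (hd : 0 < d) (hδ : ((δ : Kf i₀)) ^ 2 = -(d : Kf i₀))
    (hτ : τ (δ : Kf i₀) = Complex.I * (Real.sqrt d : ℂ))
    (hA : ∀ j, IsCMTypeRealisation (Φ₂ j) (A₂ j) (ι₂ j) (θ₂ j))
    (e : (Kf i₁ →+* ℂ) ≃ Fin 4 × Bool)
    (he_sign : ∀ s : Kf i₁ →+* ℂ, (e s).2 = true ↔ s.comp i = τ)
    (he_conj : ∀ s : Kf i₁ →+* ℂ, e (ComplexEmbedding.conjugate s) = ((e s).1, !(e s).2))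
    (hΦ : ∀ s : Kf i₁ →+* ℂ, s ∈ (Φ₂ 0).1 ↔ Sum.inr (e s) ∈ phi)
    (hΨ : ∀ σ : Kf i₀ →+* ℂ, σ ∈ (Φ₂ (0 : Fin 1).succ).1 ↔ σ = τ) :
    HodgeConjectureFor (⨁ fun j => A₂ (κ j)).dim (⨁ fun j => A₂ (κ j)).X :=
  have hττ : ComplexEmbedding.conjugate τ ≠ τ := CMThreefoldPair.conjugate_ne_of_apply_eq hd hτ
  have hk : ∀ σ : Kf i₀ →+* ℂ, σ = τ ∨ σ = ComplexEmbedding.conjugate τ := fun σ => eq_or_eq_conjugate h2 hd hτ σ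
  hodgeConjectureFor_biproduct_comp_of_weilPlane₃ κ hττ hk hτ hA he_sign he_conj hΦ hΨ
    (weilClassesOf_le_algebraicClasses_cmFourfold_prod_cmCurve_prod_cmCurve_of_markmanSixfold hM h8 h2 i (hA 0)
      (hA (0 : Fin 1).succ) hd hδ fun τ' => typeCount_eq_three_of_frame h2 hd hτ he_sign hΦ hΨ τ')

/-- **The Hodge conjecture for every abelian variety dominated by a product of copies `⨁_j A₂(κ j)`** (frame form, modulo
Markman's sixfold theorem): everything isogenous to a product of copies of `B`, `E` and their abelian subvarieties and
quotients. [cite: Markman2025SecantWeil, Thm 1.5.1] [cite: MumfordAV1970, §19] -/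
theorem hodgeConjectureFor_of_avDominatedBy_comp_of_frame_of_markmanSixfold
    (hM : Markman2025_weilClasses_algebraic_hyperbolicSixfold) (κ : Fin N → Fin 2)
    (h8 : Module.finrank ℚ (Kf i₁) = 8) (h2 : Module.finrank ℚ (Kf i₀) = 2) (i : Kf i₀ →+* Kf i₁)
    {δ : 𝓞 (Kf i₀)} {d : ℕ} (hd : 0 < d) (hδ : ((δ : Kf i₀)) ^ 2 = -(d : Kf i₀))
    (hτ : τ (δ : Kf i₀) = Complex.I * (Real.sqrt d : ℂ))
    (hA : ∀ j, IsCMTypeRealisation (Φ₂ j) (A₂ j) (ι₂ j) (θ₂ j))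
    (e : (Kf i₁ →+* ℂ) ≃ Fin 4 × Bool)
    (he_sign : ∀ s : Kf i₁ →+* ℂ, (e s).2 = true ↔ s.comp i = τ)
    (he_conj : ∀ s : Kf i₁ →+* ℂ, e (ComplexEmbedding.conjugate s) = ((e s).1, !(e s).2))
    (hΦ : ∀ s : Kf i₁ →+* ℂ, s ∈ (Φ₂ 0).1 ↔ Sum.inr (e s) ∈ phi)
    (hΨ : ∀ σ : Kf i₀ →+* ℂ, σ ∈ (Φ₂ (0 : Fin 1).succ).1 ↔ σ = τ)
    {C : AbelianVariety ℂ} (hC : Domination.AVDominatedBy C (⨁ fun j => A₂ (κ j))) :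
    HodgeConjectureFor C.dim C.X :=
  Domination.hodgeConjectureFor_of_avDominatedBy
    (hodgeConjectureFor_biproduct_comp_of_frame_of_markmanSixfold hM κ h8 h2 i hd hδ hτ hA e he_sign he_conj hΦ hΨ) hC

end Assembly

end Summit.HodgeConjecture.CorCM.OcticCurveFourfold

end
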